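import Literature.Probability.RandomPlanarGeometry.SLEExistenceConverse
import HarnessLib

/-!
# Existence of chordal SLE_κ curves, one `κ` at a time

Topic `Probability/RandomPlanarGeometry`; theorems only. The named fact
`Literature.Probability.RandomPlanarGeometry.exists_isSLECurve` ("for every `κ > 0` and every
Dobrushin domain there is a chordal SLE_κ random curve") is global in `κ`, and its reduction in the
tree (`exists_isSLECurve_of_aemeasurable`, `SLEExistence`; `exists_isSLECurve_iff`,
`SLEExistenceConverse`) consumes the three trace theorems for *all* `κ` at once — in particular the
Lawler–Schramm–Werner theorem on SLE₈ (`hasSLETrace_eight`). Consumers, however, need one value of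
`κ` each (`κ = 6`: Cardy–Smirnov in Jordan domains and the locality characterisation
`eq_six_of_forall_measureReal_hitsBefore`; `κ = 8/3`: the self-avoiding walk; `κ = 2, 4, 3, 16/3`
elsewhere). This file localises the reduction in `κ`:

* `Literature.Probability.RandomPlanarGeometry.exists_isSLECurve_at`: if SLE_κ is generated by a
  curve (`HasSLETrace κ`) and its trace is almost surely transient, then in every Dobrushin domain
  there is a chordal SLE_κ random curve (the glue — Riemann mapping, Carathéodory, measurability
  of the trace — is proved in the tree; the proof is that of `exists_isSLECurve_of_aemeasurable`
  read at one `κ`);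
* `Literature.Probability.RandomPlanarGeometry.forall_exists_isSLECurve_iff`: conversely an SLE_κ
  random curve in one Dobrushin domain witnesses `HasSLETrace κ` and transience
  (`SLEExistenceConverse`), so for `κ > 0`, "SLE_κ curves exist in all Dobrushin domains" is
  *equivalent* to "`HasSLETrace κ` and a.s. transience of the SLE_κ trace";
* hence for `κ ≠ 8` the SLE_κ curves exist from Rohde–Schramm (2005) alone
  (`exists_isSLECurve_at_of_ne_eight`: Thm. 5.1 and Thm. 7.1 at `κ`), without LSW04.

## References

* S. Rohde, O. Schramm, *Basic properties of SLE*, Ann. of Math. 161 (2005), Thm. 5.1, Thm. 7.1,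
  §3 p. 896.
* G. Lawler, O. Schramm, W. Werner, *Conformal invariance of planar loop-erased random walks and
  uniform spanning trees*, Ann. Probab. 32 (2004), Thm. 4.7.
* G. F. Lawler, *Conformally Invariant Processes in the Plane* (2005), §6.3.
-/

noncomputable section

open Set Filter Topology MeasureTheory Complex
open UpperHalfPlane (upperHalfPlaneSet isOpen_upperHalfPlaneSet)
open scoped NNReal unitInterval

namespace Literature.Probability.RandomPlanarGeometry

variable {κ : ℝ≥0}

/-- **Chordal SLE_κ in a Dobrushin domain, at one `κ`, from marginal measurability of the trace.**
If SLE_κ is generated by a curve (`hκt`), its trace is a.s. transient (`htr`), chordal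
uniformizing maps exist with continuous boundary extensions (`hunif`, `hext`; proved in the tree)
and the trace marginals are a.e.-measurable (`hmeas`; proved in the tree given `hκt`), then every
Dobrushin domain carries a chordal SLE_κ random curve. The construction is that of
`exists_isSLECurve_of_aemeasurable` (`SLEExistence`), verbatim, with the trace theorems read at
the single value `κ`: on a measurable full-measure set where the chain is generated by the
transient trace `γ` (agreeing at countably many compactified rational times with measurable
modifications), `Γ ω` is the class of `s ↦ Φ(γ(s/(1-s)))`, `1 ↦ b`; elsewhere the constant curve.
Lawler (2005), §6.3; Rohde–Schramm (2005), Thm 5.1 and Thm 7.1. [cite: RohdeSchramm2005, Thm 5.1 and Thm 7.1] -/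
theorem exists_isSLECurve_at_of_aemeasurable (hκt : HasSLETrace κ)
    (htr : ∀ᵐ ω ∂Process.preWienerMeasure, Tendsto (fun t ↦ ‖sleTrace κ ω t‖) atTop atTop)
    (hunif : MarkedDomain.exists_isChordalUniformizing)
    (hext : JordanDomain.continuousOn_boundaryExtension)
    (hmeas : ∀ t : ℝ≥0, AEMeasurable (fun ω ↦ sleTrace κ ω t) Process.preWienerMeasure)
    (D : DobrushinDomain) : ∃ Γ, IsSLECurve κ D Γ := by
  classical
  -- the inputs
  obtain ⟨φ, hφ⟩ := hunif D
  set Φ : ℂ → ℂ := φ.boundaryExtension with hΦdef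
  set b : ℂ := D.pt 1 with hbdef
  have hΦcont : ContinuousOn Φ (closure upperHalfPlaneSet) := hext D.toJordanDomain φ
  have hΦinf : Tendsto Φ (cocompact ℂ ⊓ 𝓟 (closure upperHalfPlaneSet)) (𝓝 b) :=
    φ.tendsto_boundaryExtension_cocompact hΦcont hφ.2
  set γ : (ℝ≥0 → ℝ) → ℝ≥0 → ℂ := fun ω ↦ sleTrace κ ω with hγdef
  -- a countable dense set of parameters and measurable modifications of the marginals there
  obtain ⟨S, hSc, hSd⟩ := TopologicalSpace.exists_countable_dense I
  haveI : Countable S := hSc.to_subtype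
  have hm : ∀ s : S, AEMeasurable (fun ω ↦ γ ω (rayParam s)) Process.preWienerMeasure :=
    fun s ↦ hmeas (rayParam s)
  set g : S → (ℝ≥0 → ℝ) → ℂ := fun s ↦ (hm s).mk _ with hgdef
  have hgm : ∀ s, Measurable (g s) := fun s ↦ (hm s).measurable_mk
  -- the good event, of full measure
  set G : Set (ℝ≥0 → ℝ) := {ω | Loewner.IsGeneratedByCurve (sleDriving κ ω) (γ ω) ∧
    Tendsto (fun t ↦ ‖γ ω t‖) atTop atTop ∧ ∀ s : S, γ ω (rayParam s) = g s ω} with hGdef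
  have hG : ∀ᵐ ω ∂Process.preWienerMeasure, ω ∈ G := by
    have h3 : ∀ᵐ ω ∂Process.preWienerMeasure, ∀ s : S, γ ω (rayParam s) = g s ω :=
      ae_all_iff.2 fun s ↦ (hm s).ae_eq_mk
    filter_upwards [ae_isGeneratedByCurve_sleTrace hκt, htr, h3] with ω h1 h2 h3
    exact ⟨h1, h2, h3⟩
  obtain ⟨N, hGN, hNm, hN0⟩ := exists_measurable_superset_of_null (ae_iff.1 hG)
  have hgood : ∀ ω, ω ∈ Nᶜ → ω ∈ G := fun ω hω ↦ by
    by_contra hωG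
    exact hω (hGN hωG)
  have hae : ∀ᵐ ω ∂Process.preWienerMeasure, ω ∈ Nᶜ := measure_eq_zero_iff_ae_notMem.1 hN0
  -- the curve on the good event
  have hcurve : ∀ ω, ω ∈ Nᶜ → Continuous (nodeValue Φ b (γ ω)) := fun ω hω ↦
    continuous_nodeValue hΦcont hΦinf (hgood ω hω).1.continuous
      (fun t ↦ sleTrace_mem_closure κ ω t) (tendsto_cocompact_of_tendsto_norm_atTop (hgood ω hω).2.1)
  set f : (Nᶜ : Set (ℝ≥0 → ℝ)) → CurveClass ℂ :=
    fun ω ↦ CurveClass.mk ⟨⟨nodeValue Φ b (γ ω), hcurve ω ω.2⟩⟩ with hfdef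
  -- measurability of `f` on the good event
  have hf : Measurable f := by
    refine measurable_curveClassMk (fun ω : (Nᶜ : Set (ℝ≥0 → ℝ)) ↦ hcurve ω ω.2) hSc hSd ?_
    intro s hs
    by_cases hs1 : (s : ℝ) < 1
    · -- `ω ↦ Φ (γ ω (rayParam s)) = Φ (g s ω)`, and `Φ` is continuous on the closed half-plane
      have hΦr : Continuous ((closure upperHalfPlaneSet).restrict Φ) :=
        continuousOn_iff_continuous_restrict.1 hΦcont
      have hgs : Measurable fun ω : (Nᶜ : Set (ℝ≥0 → ℝ)) ↦
          (⟨γ ω (rayParam s), sleTrace_mem_closure κ ω _⟩ : closure upperHalfPlaneSet) := by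
        refine Measurable.subtype_mk ?_
        have heq : (fun ω : (Nᶜ : Set (ℝ≥0 → ℝ)) ↦ γ ω (rayParam s)) =
            fun ω : (Nᶜ : Set (ℝ≥0 → ℝ)) ↦ g ⟨s, hs⟩ ω :=
          funext fun ω ↦ (hgood ω ω.2).2.2 ⟨s, hs⟩
        rw [heq]
        exact (hgm ⟨s, hs⟩).comp measurable_subtype_coe
      have heq : (fun ω : (Nᶜ : Set (ℝ≥0 → ℝ)) ↦ nodeValue Φ b (γ ω) s) =
          fun ω : (Nᶜ : Set (ℝ≥0 → ℝ)) ↦ (closure upperHalfPlaneSet).restrict Φ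
            ⟨γ ω (rayParam s), sleTrace_mem_closure κ ω _⟩ :=
        funext fun ω ↦ nodeValue_of_lt Φ b (γ ω) hs1
      rw [heq]
      exact hΦr.measurable.comp hgs
    · obtain rfl : s = 1 := Subtype.ext (le_antisymm s.2.2 (not_lt.1 hs1))
      simp only [nodeValue_one]
      exact measurable_const
  -- the random curve
  refine ⟨fun ω ↦ if hω : ω ∈ Nᶜ then f ⟨ω, hω⟩ else CurveClass.mk (Curve.const b), ?_, φ, hφ, ?_⟩
  · exact (Measurable.dite hf measurable_const hNm.compl).aemeasurable
  · filter_upwards [hae] with ω hω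
    refine ⟨(hgood ω hω).1, ⟨⟨nodeValue Φ b (γ ω), hcurve ω hω⟩⟩, ?_, ?_, ?_⟩
    · simp only [dif_pos hω, hfdef]
    · intro s hs
      exact nodeValue_of_lt Φ b (γ ω) hs
    · exact nodeValue_one Φ b (γ ω)

/-- **Chordal SLE_κ random curves exist, at one `κ`, as soon as SLE_κ is generated by an a.s.
transient curve**: for every Dobrushin domain `(D; a, b)` there is `Γ` with `IsSLECurve κ D Γ`.
The uniformizing maps (`MarkedDomain.exists_isChordalUniformizing_holds`: Riemann mapping +
Carathéodory), the continuity of their boundary extensions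
(`JordanDomain.continuousOn_boundaryExtension_holds`, Pommerenke Thm. 2.1) and the measurability
of the trace marginals (`aemeasurable_sleTrace_holds`, RS05 §3) are theorems of the tree. So the
only inputs are the two trace theorems *at `κ`*: generation by a curve (Rohde–Schramm (2005),
Thm. 5.1 for `κ ≠ 8`; Lawler–Schramm–Werner (2004), Thm. 4.7 for `κ = 8`) and transience
(Rohde–Schramm (2005), Thm. 7.1). [cite: RohdeSchramm2005, Thm 5.1 and Thm 7.1] -/
theorem exists_isSLECurve_at (hκt : HasSLETrace κ)
    (htr : ∀ᵐ ω ∂Process.preWienerMeasure, Tendsto (fun t ↦ ‖sleTrace κ ω t‖) atTop atTop)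
    (D : DobrushinDomain) : ∃ Γ, IsSLECurve κ D Γ :=
  exists_isSLECurve_at_of_aemeasurable hκt htr MarkedDomain.exists_isChordalUniformizing_holds
    JordanDomain.continuousOn_boundaryExtension_holds (aemeasurable_sleTrace_holds hκt) D

/-- An SLE_κ random curve in some Dobrushin domain witnesses that SLE_κ is generated by a curve
and that its trace is a.s. transient (`IsSLECurve.hasSLETrace`,
`IsSLECurve.ae_tendsto_norm_sleTrace_atTop` of `SLEExistenceConverse`). [cite: RohdeSchramm2005, Thm 5.1 and Thm 7.1] -/
theorem hasSLETrace_and_transient_of_isSLECurve {D : DobrushinDomain}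
    {Γ : (ℝ≥0 → ℝ) → CurveClass ℂ} (h : IsSLECurve κ D Γ) :
    HasSLETrace κ ∧
      ∀ᵐ ω ∂Process.preWienerMeasure, Tendsto (fun t ↦ ‖sleTrace κ ω t‖) atTop atTop :=
  ⟨h.hasSLETrace, h.ae_tendsto_norm_sleTrace_atTop⟩

/-- **Existence of chordal SLE_κ curves in all Dobrushin domains is equivalent, at each `κ`, to
"SLE_κ is generated by an a.s. transient curve"** (given one Dobrushin domain `D₀` to test on;
Dobrushin domains exist, e.g. marked triangles). `→`: `SLEExistenceConverse`; `←`: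
`exists_isSLECurve_at`. [cite: RohdeSchramm2005, Thm 5.1 and Thm 7.1] -/
theorem forall_exists_isSLECurve_iff (D₀ : DobrushinDomain) :
    (∀ D : DobrushinDomain, ∃ Γ, IsSLECurve κ D Γ) ↔
      (HasSLETrace κ ∧
        ∀ᵐ ω ∂Process.preWienerMeasure, Tendsto (fun t ↦ ‖sleTrace κ ω t‖) atTop atTop) := by
  refine ⟨fun h ↦ ?_, fun h D ↦ exists_isSLECurve_at h.1 h.2 D⟩
  obtain ⟨Γ, hΓ⟩ := h D₀
  exact hasSLETrace_and_transient_of_isSLECurve hΓ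

/-- **For `κ ≠ 8` the chordal SLE_κ curves exist from Rohde–Schramm (2005) alone**: Thm. 5.1
(`hasSLETrace_of_ne_eight`, at `κ`) and Thm. 7.1 (`tendsto_norm_sleTrace_atTop`, at `κ`); the
SLE₈ theorem of Lawler–Schramm–Werner (2004) is not involved. This is the form needed at
`κ = 6` (critical percolation), `κ = 8/3` (self-avoiding walk), `κ = 2, 3, 4, 16/3`.
[cite: RohdeSchramm2005, Thm 5.1 and Thm 7.1] -/
theorem exists_isSLECurve_at_of_ne_eight (hne : hasSLETrace_of_ne_eight)
    (htr : tendsto_norm_sleTrace_atTop) (hκ : 0 < κ) (h8 : κ ≠ 8) (D : DobrushinDomain) :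
    ∃ Γ, IsSLECurve κ D Γ :=
  exists_isSLECurve_at (hne h8) (htr hκ) D

/-- The global named fact from the per-`κ` construction (same content as
`exists_isSLECurve_of_trace_theorems`, now factored through `exists_isSLECurve_at`).
[cite: RohdeSchramm2005, Thm 5.1 and Thm 7.1] -/
theorem exists_isSLECurve_of_forall_hasSLETrace_transient
    (h : ∀ κ : ℝ≥0, 0 < κ → HasSLETrace κ ∧
      ∀ᵐ ω ∂Process.preWienerMeasure, Tendsto (fun t ↦ ‖sleTrace κ ω t‖) atTop atTop) :
    exists_isSLECurve :=
  fun {κ} hκ D ↦ exists_isSLECurve_at (h κ hκ).1 (h κ hκ).2 D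

end Literature.Probability.RandomPlanarGeometry
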